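import Summits.QuantumFields.YangMills.Theorems.AlphaInputsT3ACv3PerturbedPlaquette
import HarnessLib

/-!
# `AlphaInputsT3ACv3FLPlaqUpdate` — non-abelian (FL), Newton row R6 (PLAQUETTES OF THE UPDATE; w1-19936 g0 HANDOFF step (1), «NOT LANDED»): **`dist1 U′(∂q) ≤ (1 + 2α)·dist1 U(∂q) +
# ‖curl a (q)‖ + 8αδ + (e^{4α} − 1 − 4α)`** for the exponential update `U′ = e^{a}U` (`‖a_b‖ ≤ α`, `a_b* = −a_b`, the three transporting bond variables of `q` within `δ` of `1`) — the fine
# plaquettes move by the FLAT matrix curl of the (sup- AND curl-small) update plus `O(α(α + δ))` and `O(α·dist1 U(∂q))`; NO pure `δ²` term, so the plaquette increments are SUMMABLE along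
# the contraction — cell `ym3-torus`, width seat `ym-ust-19936-w2` (g2), from w4-19936's covariant ledger `…v3PerturbedPlaquette`

WHY (w1-19936 `NONABELIAN-FL-NEWTON-w1-g0.md` §2 R6–R7; w1 DONE∕HANDOFF 2026-08-28T01:28:57Z: «NOT LANDED: PlaqUpdate (eight-factor telescope) … needed so plaquette increments are SUMMABLE along the
iteration»).  The limit field of the contraction must keep its finest plaquettes under `Ω` below `B·ε·L^{−2k}`; at step `j` the update `a_j = liftSM Δ_j` has `α_j = O(|Δ_j|/L^k)` and
`‖curl a_j‖ = O(|Δ_j|/L^{2k})` (`…LinearLiftSmooth`, `…LinearLiftMatrixCLM`), with `|Δ_j|` geometric; an increment bound `‖curl a_j‖ + O(α_j(α_j + δ) + α_j·dist1)` is then summable with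
sum `O(ε·L^{−2k})` (`δ = O(ε/L^k)` in the stencil gauge), whereas a crude expansion around `1` would cost a non-summable `O(δ²)` per step.
ROUTE (no eight-factor telescope).  w4-19936's EXACT covariant ledger `dist1_plaqHol_perturb_le` (p592039) already isolates `dist1 U(∂q)`, the COVARIANT curl
`a₁ + U₁a₂U₁* − g a₃ g* − W a₄ W*` and the second order `e^{4α} − 1 − 4α`; un-transporting the three conjugated slots costs `2‖U₁ − 1‖·α + 2‖g − 1‖·α + 2‖W − 1‖·α ≤ 8αδ + 2α·dist1 U(∂q)`
(`Prop7CovariantCoercivity.norm_conj_sub_self_le'`, `‖AB − 1‖ ≤ ‖A − 1‖ + ‖B − 1‖` on `SU(n)`).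
WHAT (no definitions).  §1 `norm_coe_inv_sub_one` (`‖U⁻¹ − 1‖ = ‖U − 1‖`), `norm_coe_mul_sub_one_le` (`‖AB − 1‖ ≤ ‖A − 1‖ + ‖B − 1‖`), `norm_coe_triple_sub_one_le` (`g = U₁U₂U₃⁻¹`: `≤ 3δ`);
§2 ★ `norm_covCurl_sub_curl_le` (covariant minus flat curl `≤ 8αδ + 2α·dist1 U(∂q)`); §3 ★★ `dist1_plaqHol_expUpdate_le` (displayed), `dist1_plaqHol_expUpdate_le'` (`4α ≤ 1`: second order `≤ 16α²`).
The flat curl is `…LinearLiftMatrix.curlM a q.src q.μ q.ν` verbatim (`a₁ + a₂ − a₃ − a₄`), spelled out to keep this file on w4's imports only.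
HONEST FRAMING.  Matrix bookkeeping; count-neutral helper toward R3 2′ (items 19936∕19935, `--supports stmt-QuantumFields-19936`); `hLift`∕(FL) NOT proved; registry untouched; nothing about
d = 4, the continuum, or a mass gap; YM₃ on T³ is rung R3, not the Clay problem.

References: T. Bałaban, Commun. Math. Phys. 98 (1985) 17–51 [Balaban1985Averaging] ((9) p.18, (19) p.21); CMP 99 (1985) 75–102 [Balaban1985RegularSpaces] (p.84, the remainder
«O₁((1/2!)η²(∂|A|(p))²)»).
-/

set_option autoImplicit false

noncomputable section

open scoped Matrix.Norms.L2Operator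
open NormedSpace

namespace Summit.QuantumFields.YangMills.Theorems.FLPlaqUpdate

open Literature.MathematicalPhysics.QuantumFieldTheory.Balaban1983to89
open Literature.MathematicalPhysics.QuantumLattice (coe_inv_eq_star)
open Summit.QuantumFields.YangMills.Theorems.Prop7CovariantCoercivity (norm_conj_sub_self_le')
open Summit.QuantumFields.YangMills.Theorems.PerturbedPlaquette (dist1_SU_eq dist1_plaqHol_perturb_le exp_four_mul_sub_le_sq)

variable {n : Type*} [Fintype n] [DecidableEq n]

/-! ## §1 Near-identity bookkeeping in `SU(n)` -/

/-- `‖U⁻¹ − 1‖ = ‖U − 1‖` in `SU(n)` (`U⁻¹ = U*`, the norm is star-invariant). [cite: Balaban1985Averaging, (19) p.21] -/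
theorem norm_coe_inv_sub_one (U : Matrix.specialUnitaryGroup n ℂ) :
    ‖((U⁻¹ : Matrix.specialUnitaryGroup n ℂ) : Matrix n n ℂ) - 1‖ = ‖(U : Matrix n n ℂ) - 1‖ := by
  have e : star ((U : Matrix n n ℂ) - 1) = star (U : Matrix n n ℂ) - 1 := by rw [star_sub, star_one]
  rw [coe_inv_eq_star, ← e, norm_star]

/-- `‖AB − 1‖ ≤ ‖A − 1‖ + ‖B − 1‖` for `A, B ∈ SU(n)` (`AB − 1 = (A − 1)B + (B − 1)`, `‖B‖ = 1`). [cite: Balaban1985Averaging, (19) p.21] -/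
theorem norm_coe_mul_sub_one_le (A B : Matrix.specialUnitaryGroup n ℂ) :
    ‖((A * B : Matrix.specialUnitaryGroup n ℂ) : Matrix n n ℂ) - 1‖ ≤ ‖(A : Matrix n n ℂ) - 1‖ + ‖(B : Matrix n n ℂ) - 1‖ := by
  have e : ((A * B : Matrix.specialUnitaryGroup n ℂ) : Matrix n n ℂ) - 1 = ((A : Matrix n n ℂ) - 1) * (B : Matrix n n ℂ) + ((B : Matrix n n ℂ) - 1) := by
    rw [Submonoid.coe_mul]; noncomm_ring
  rw [e]
  calc ‖((A : Matrix n n ℂ) - 1) * (B : Matrix n n ℂ) + ((B : Matrix n n ℂ) - 1)‖ ≤ ‖((A : Matrix n n ℂ) - 1) * (B : Matrix n n ℂ)‖ + ‖(B : Matrix n n ℂ) - 1‖ := norm_add_le _ _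
    _ = ‖(A : Matrix n n ℂ) - 1‖ + ‖(B : Matrix n n ℂ) - 1‖ := by rw [CStarRing.norm_mul_mem_unitary _ B.2.1]

/-- The transporting product `g = U₁U₂U₃⁻¹` of a plaquette is within `3δ` of `1` when its three bond variables are within `δ`. [cite: Balaban1985Averaging, (9) p.18, (19) p.21] -/
theorem norm_coe_triple_sub_one_le (U₁ U₂ U₃ : Matrix.specialUnitaryGroup n ℂ) {δ : ℝ}
    (h₁ : ‖(U₁ : Matrix n n ℂ) - 1‖ ≤ δ) (h₂ : ‖(U₂ : Matrix n n ℂ) - 1‖ ≤ δ) (h₃ : ‖(U₃ : Matrix n n ℂ) - 1‖ ≤ δ) :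
    ‖((U₁ * U₂ * U₃⁻¹ : Matrix.specialUnitaryGroup n ℂ) : Matrix n n ℂ) - 1‖ ≤ 3 * δ := by
  have h := (norm_coe_mul_sub_one_le (U₁ * U₂) U₃⁻¹).trans (add_le_add (norm_coe_mul_sub_one_le U₁ U₂) le_rfl)
  rw [norm_coe_inv_sub_one] at h
  linarith

/-! ## §2 The covariant curl against the flat curl -/

variable [Nonempty n] {P : Params} {j : ℕ}

/-- **★ UN-TRANSPORTING THE COVARIANT CURL**: with `‖a_b‖ ≤ α` on the bonds `b₂, b₃, b₄` of `q` and `‖U_b − 1‖ ≤ δ` on `b₁, b₂, b₃`,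
`‖(a₁ + U₁a₂U₁* − g a₃ g* − W a₄ W*) − (a₁ + a₂ − a₃ − a₄)‖ ≤ 8αδ + 2α·dist1 U(∂q)` (`g = U₁U₂U₃⁻¹` within `3δ`, `W = U(∂q)`; each slot by `‖PXP* − X‖ ≤ 2‖P − 1‖‖X‖`).
[cite: Balaban1985Averaging, (9) p.18, (19) p.21] -/
theorem norm_covCurl_sub_curl_le (U : GaugeField P j (Matrix.specialUnitaryGroup n ℂ)) (a : PBond P j → Matrix n n ℂ) (q : Plaq P j) {α δ : ℝ}
    (h₂ : ‖a ⟨q.src.shift q.μ, q.ν⟩‖ ≤ α) (h₃ : ‖a ⟨q.src.shift q.ν, q.μ⟩‖ ≤ α) (h₄ : ‖a ⟨q.src, q.ν⟩‖ ≤ α)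
    (hU₁ : ‖(U ⟨q.src, q.μ⟩ : Matrix n n ℂ) - 1‖ ≤ δ) (hU₂ : ‖(U ⟨q.src.shift q.μ, q.ν⟩ : Matrix n n ℂ) - 1‖ ≤ δ) (hU₃ : ‖(U ⟨q.src.shift q.ν, q.μ⟩ : Matrix n n ℂ) - 1‖ ≤ δ) :
    ‖(a ⟨q.src, q.μ⟩ + (U ⟨q.src, q.μ⟩ : Matrix n n ℂ) * a ⟨q.src.shift q.μ, q.ν⟩ * star (U ⟨q.src, q.μ⟩ : Matrix n n ℂ)
        - ((U ⟨q.src, q.μ⟩ * U ⟨q.src.shift q.μ, q.ν⟩ * (U ⟨q.src.shift q.ν, q.μ⟩)⁻¹ : Matrix.specialUnitaryGroup n ℂ) : Matrix n n ℂ) * a ⟨q.src.shift q.ν, q.μ⟩ *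
            star ((U ⟨q.src, q.μ⟩ * U ⟨q.src.shift q.μ, q.ν⟩ * (U ⟨q.src.shift q.ν, q.μ⟩)⁻¹ : Matrix.specialUnitaryGroup n ℂ) : Matrix n n ℂ)
        - ((GaugeField.plaqHol U q : Matrix.specialUnitaryGroup n ℂ) : Matrix n n ℂ) * a ⟨q.src, q.ν⟩ *
            star ((GaugeField.plaqHol U q : Matrix.specialUnitaryGroup n ℂ) : Matrix n n ℂ))
      - (a ⟨q.src, q.μ⟩ + a ⟨q.src.shift q.μ, q.ν⟩ - a ⟨q.src.shift q.ν, q.μ⟩ - a ⟨q.src, q.ν⟩)‖ ≤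
      8 * α * δ + 2 * α * GaugeGroup.dist1 (GaugeField.plaqHol U q) := by
  set U₁ : Matrix.specialUnitaryGroup n ℂ := U ⟨q.src, q.μ⟩
  set g : Matrix.specialUnitaryGroup n ℂ := U ⟨q.src, q.μ⟩ * U ⟨q.src.shift q.μ, q.ν⟩ * (U ⟨q.src.shift q.ν, q.μ⟩)⁻¹ with hg
  set W : Matrix.specialUnitaryGroup n ℂ := GaugeField.plaqHol U q with hW
  set a₁ : Matrix n n ℂ := a ⟨q.src, q.μ⟩
  set a₂ : Matrix n n ℂ := a ⟨q.src.shift q.μ, q.ν⟩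
  set a₃ : Matrix n n ℂ := a ⟨q.src.shift q.ν, q.μ⟩
  set a₄ : Matrix n n ℂ := a ⟨q.src, q.ν⟩
  have hα : 0 ≤ α := (norm_nonneg _).trans h₂
  have hδ : 0 ≤ δ := (norm_nonneg _).trans hU₁
  have e : (a₁ + (U₁ : Matrix n n ℂ) * a₂ * star (U₁ : Matrix n n ℂ) - (g : Matrix n n ℂ) * a₃ * star (g : Matrix n n ℂ) - (W : Matrix n n ℂ) * a₄ * star (W : Matrix n n ℂ))
        - (a₁ + a₂ - a₃ - a₄) =
      ((U₁ : Matrix n n ℂ) * a₂ * star (U₁ : Matrix n n ℂ) - a₂) - ((g : Matrix n n ℂ) * a₃ * star (g : Matrix n n ℂ) - a₃) - ((W : Matrix n n ℂ) * a₄ * star (W : Matrix n n ℂ) - a₄) := by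
    abel
  rw [e]
  have s₂ : ‖(U₁ : Matrix n n ℂ) * a₂ * star (U₁ : Matrix n n ℂ) - a₂‖ ≤ 2 * δ * α :=
    (norm_conj_sub_self_le' U₁ a₂).trans (mul_le_mul (mul_le_mul_of_nonneg_left hU₁ (by norm_num)) h₂ (norm_nonneg _) (by linarith))
  have hg3 : ‖(g : Matrix n n ℂ) - 1‖ ≤ 3 * δ := norm_coe_triple_sub_one_le _ _ _ hU₁ hU₂ hU₃
  have s₃ : ‖(g : Matrix n n ℂ) * a₃ * star (g : Matrix n n ℂ) - a₃‖ ≤ 2 * (3 * δ) * α :=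
    (norm_conj_sub_self_le' g a₃).trans (mul_le_mul (mul_le_mul_of_nonneg_left hg3 (by norm_num)) h₃ (norm_nonneg _) (by linarith))
  have s₄ : ‖(W : Matrix n n ℂ) * a₄ * star (W : Matrix n n ℂ) - a₄‖ ≤ 2 * GaugeGroup.dist1 W * α := by
    rw [dist1_SU_eq]
    exact (norm_conj_sub_self_le' W a₄).trans (mul_le_mul_of_nonneg_left h₄ (by positivity))
  calc ‖((U₁ : Matrix n n ℂ) * a₂ * star (U₁ : Matrix n n ℂ) - a₂) - ((g : Matrix n n ℂ) * a₃ * star (g : Matrix n n ℂ) - a₃) - ((W : Matrix n n ℂ) * a₄ * star (W : Matrix n n ℂ) - a₄)‖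
      ≤ ‖(U₁ : Matrix n n ℂ) * a₂ * star (U₁ : Matrix n n ℂ) - a₂‖ + ‖(g : Matrix n n ℂ) * a₃ * star (g : Matrix n n ℂ) - a₃‖ + ‖(W : Matrix n n ℂ) * a₄ * star (W : Matrix n n ℂ) - a₄‖ :=
        (norm_sub_le _ _).trans (add_le_add (norm_sub_le _ _) le_rfl)
    _ ≤ 2 * δ * α + 2 * (3 * δ) * α + 2 * GaugeGroup.dist1 W * α := add_le_add (add_le_add s₂ s₃) s₄
    _ = 8 * α * δ + 2 * α * GaugeGroup.dist1 W := by ring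

/-! ## §3 The plaquettes of the exponential update -/

/-- **★★ THE PLAQUETTE LEDGER OF THE UPDATE WITH THE FLAT CURL**: for `U′_b = e^{a_b}U_b` (`a_b* = −a_b`, `‖a_b‖ ≤ α` on the four bonds of `q`, `‖U_b − 1‖ ≤ δ` on the three transporting
bonds), `dist1 U′(∂q) ≤ (1 + 2α)·dist1 U(∂q) + ‖a₁ + a₂ − a₃ − a₄‖ + 8αδ + (e^{4α} − 1 − 4α)` — the increment is the flat matrix curl of the update plus terms `O(α(α + δ))` and
`O(α·dist1 U(∂q))`, with NO pure `δ²`. [cite: Balaban1985Averaging, (9) p.18, (19) p.21; Balaban1985RegularSpaces, p.84] -/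
theorem dist1_plaqHol_expUpdate_le (U U' : GaugeField P j (Matrix.specialUnitaryGroup n ℂ)) (a : PBond P j → Matrix n n ℂ)
    (hstar : ∀ b, star (a b) = -a b) (hU' : ∀ b, ((U' b : Matrix.specialUnitaryGroup n ℂ) : Matrix n n ℂ) = exp (a b) * (U b : Matrix n n ℂ))
    (q : Plaq P j) {α δ : ℝ} (h₁ : ‖a ⟨q.src, q.μ⟩‖ ≤ α) (h₂ : ‖a ⟨q.src.shift q.μ, q.ν⟩‖ ≤ α) (h₃ : ‖a ⟨q.src.shift q.ν, q.μ⟩‖ ≤ α) (h₄ : ‖a ⟨q.src, q.ν⟩‖ ≤ α)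
    (hU₁ : ‖(U ⟨q.src, q.μ⟩ : Matrix n n ℂ) - 1‖ ≤ δ) (hU₂ : ‖(U ⟨q.src.shift q.μ, q.ν⟩ : Matrix n n ℂ) - 1‖ ≤ δ) (hU₃ : ‖(U ⟨q.src.shift q.ν, q.μ⟩ : Matrix n n ℂ) - 1‖ ≤ δ) :
    GaugeGroup.dist1 (GaugeField.plaqHol U' q) ≤ (1 + 2 * α) * GaugeGroup.dist1 (GaugeField.plaqHol U q) +
      ‖a ⟨q.src, q.μ⟩ + a ⟨q.src.shift q.μ, q.ν⟩ - a ⟨q.src.shift q.ν, q.μ⟩ - a ⟨q.src, q.ν⟩‖ + 8 * α * δ + (Real.exp (4 * α) - 1 - 4 * α) := by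
  have h := dist1_plaqHol_perturb_le U U' a hstar hU' q h₁ h₂ h₃ h₄
  have hc := norm_covCurl_sub_curl_le U a q h₂ h₃ h₄ hU₁ hU₂ hU₃
  have tri := norm_le_insert'
    (a ⟨q.src, q.μ⟩ + (U ⟨q.src, q.μ⟩ : Matrix n n ℂ) * a ⟨q.src.shift q.μ, q.ν⟩ * star (U ⟨q.src, q.μ⟩ : Matrix n n ℂ)
        - ((U ⟨q.src, q.μ⟩ * U ⟨q.src.shift q.μ, q.ν⟩ * (U ⟨q.src.shift q.ν, q.μ⟩)⁻¹ : Matrix.specialUnitaryGroup n ℂ) : Matrix n n ℂ) * a ⟨q.src.shift q.ν, q.μ⟩ *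
            star ((U ⟨q.src, q.μ⟩ * U ⟨q.src.shift q.μ, q.ν⟩ * (U ⟨q.src.shift q.ν, q.μ⟩)⁻¹ : Matrix.specialUnitaryGroup n ℂ) : Matrix n n ℂ)
        - ((GaugeField.plaqHol U q : Matrix.specialUnitaryGroup n ℂ) : Matrix n n ℂ) * a ⟨q.src, q.ν⟩ *
            star ((GaugeField.plaqHol U q : Matrix.specialUnitaryGroup n ℂ) : Matrix n n ℂ))
    (a ⟨q.src, q.μ⟩ + a ⟨q.src.shift q.μ, q.ν⟩ - a ⟨q.src.shift q.ν, q.μ⟩ - a ⟨q.src, q.ν⟩)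
  linarith

/-- The same with the second order bounded numerically: `4α ≤ 1` ⇒ `e^{4α} − 1 − 4α ≤ 16α²`. [cite: Balaban1985Averaging, (9) p.18, (19) p.21] -/
theorem dist1_plaqHol_expUpdate_le' (U U' : GaugeField P j (Matrix.specialUnitaryGroup n ℂ)) (a : PBond P j → Matrix n n ℂ)
    (hstar : ∀ b, star (a b) = -a b) (hU' : ∀ b, ((U' b : Matrix.specialUnitaryGroup n ℂ) : Matrix n n ℂ) = exp (a b) * (U b : Matrix n n ℂ))
    (q : Plaq P j) {α δ : ℝ} (h4α : 4 * α ≤ 1) (h₁ : ‖a ⟨q.src, q.μ⟩‖ ≤ α) (h₂ : ‖a ⟨q.src.shift q.μ, q.ν⟩‖ ≤ α) (h₃ : ‖a ⟨q.src.shift q.ν, q.μ⟩‖ ≤ α) (h₄ : ‖a ⟨q.src, q.ν⟩‖ ≤ α)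
    (hU₁ : ‖(U ⟨q.src, q.μ⟩ : Matrix n n ℂ) - 1‖ ≤ δ) (hU₂ : ‖(U ⟨q.src.shift q.μ, q.ν⟩ : Matrix n n ℂ) - 1‖ ≤ δ) (hU₃ : ‖(U ⟨q.src.shift q.ν, q.μ⟩ : Matrix n n ℂ) - 1‖ ≤ δ) :
    GaugeGroup.dist1 (GaugeField.plaqHol U' q) ≤ (1 + 2 * α) * GaugeGroup.dist1 (GaugeField.plaqHol U q) +
      ‖a ⟨q.src, q.μ⟩ + a ⟨q.src.shift q.μ, q.ν⟩ - a ⟨q.src.shift q.ν, q.μ⟩ - a ⟨q.src, q.ν⟩‖ + 8 * α * δ + 16 * α ^ 2 := by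
  have hα : 0 ≤ α := (norm_nonneg _).trans h₁
  have h := dist1_plaqHol_expUpdate_le U U' a hstar hU' q h₁ h₂ h₃ h₄ hU₁ hU₂ hU₃
  have h16 := exp_four_mul_sub_le_sq hα h4α
  linarith

end Summit.QuantumFields.YangMills.Theorems.FLPlaqUpdate

end
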